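import Summits.Ventures.PercRepro.S1CoreLPIncidence

/-!
# PercRepro — THE CELL-SIDE TOOLS OF THE COLOOP/CLOSURE LP: THE `U`-BOUND, THE `Y`-SUM, THE RANK-CLASS COVER,
THE ZERO CLASSES (p2, gen 29; SUBCLAIM-S1 §6.10 (xviii))

For a matroid of rank `p ≥ 1` on `n = p + d ≥ 4` points the `U`-set of the `(p, 4)` body — the spanning sets whose
complement has rank `4` — is, by complement, the family of rank-`4` sets `B` with spanning complement; `|B| ≤ d`, and
the `4`-sets among them are all the `4`-sets but those whose complement is a non-spanning `(n − 4)`-set: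
`#U + #{(n−4)-sets of rank ≤ p − 1} ≤ C(n, 4) + Σ_{5 ≤ k ≤ d} m[k, 4]`. The `Y`-set of a cell `(p, q)` is the disjoint
union of the rank levels `q + 1 … p − 1`. Every `k`-set (`k ≥ 2`) lies in one of the rank classes `2 … p`; the rank
classes of one size sit inside the low-rank sets; and a rank-`r` set (`r < p`) of a coloop-free matroid has at most
`n − (p − r + 1)` points. Nothing is claimed about any cell.

* **`ncard_U_add_le`**, `ncard_Y_eq_sum`, `choose_le_sum_ncard_rkSets`, `sum_ncard_rkSets_le_ncard_lowRankSets`,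
  `rkSets_eq_empty_of_coloops`, `rkSets_eq_empty_of_lines`; the instances **`up_instance`**, **`cl_instance`** (and their «lines ≤ 3» forms
  `up_instance_lines`, `cl_instance_lines`).
Axioms: standard.
-/

open scoped Matroid

namespace PercRepro

namespace S1

open Set

variable {α : Type} {M : Matroid α} [M.Finite]

/-- **THE `U`-BOUND**: `#U + #{(n−4)-sets of rank ≤ p − 1} ≤ C(n, 4) + Σ_{5 ≤ k ≤ d} m[k, 4]`. -/
theorem ncard_U_add_le {p n d : ℕ} (hM : M.eRank = (p : ℕ∞)) (hp : 1 ≤ p) (hn : M.E.ncard = n) (hn4 : 4 ≤ n)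
    (hd : n = p + d) :
    {A : Set α | A ⊆ M.E ∧ M.eRk A = (p : ℕ∞) ∧ M.eRk (M.E \ A) = ((4 : ℕ) : ℕ∞)}.ncard +
      (lowRankSets M (n - 4) (p - 1)).ncard ≤
      Nat.choose n 4 + ∑ k ∈ Finset.Icc 5 d, (rkSets M k 4).ncard := by
  have hEfin := M.ground_finite
  -- pass to the complements
  have hU : {A : Set α | A ⊆ M.E ∧ M.eRk A = (p : ℕ∞) ∧ M.eRk (M.E \ A) = ((4 : ℕ) : ℕ∞)}.ncard =
      {B : Set α | B ⊆ M.E ∧ M.eRk (M.E \ B) = (p : ℕ∞) ∧ M.eRk B = ((4 : ℕ) : ℕ∞)}.ncard := by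
    have h := ncard_setOf_compl_eq M.E (fun A => M.eRk A = (p : ℕ∞) ∧ M.eRk (M.E \ A) = ((4 : ℕ) : ℕ∞))
    rw [← h]
    congr 1
    ext B
    simp only [mem_setOf_eq]
    constructor
    · rintro ⟨hB, h1, h2⟩
      rw [sdiff_sdiff_cancel_left hB] at h2
      exact ⟨hB, h1, h2⟩
    · rintro ⟨hB, h1, h2⟩
      refine ⟨hB, h1, ?_⟩
      rw [sdiff_sdiff_cancel_left hB]
      exact h2
  set W := {B : Set α | B ⊆ M.E ∧ M.eRk (M.E \ B) = (p : ℕ∞) ∧ M.eRk B = ((4 : ℕ) : ℕ∞)} with hWdef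
  set W4 := {B : Set α | B ⊆ M.E ∧ B.ncard = 4 ∧ M.eRk (M.E \ B) = (p : ℕ∞)} with hW4def
  set W4' := {B : Set α | B ⊆ M.E ∧ B.ncard = 4 ∧ M.eRk (M.E \ B) ≤ ((p - 1 : ℕ) : ℕ∞)} with hW4'def
  have hW4fin : W4.Finite := hEfin.finite_subsets.subset (fun _ h => h.1)
  have hW4'fin : W4'.Finite := hEfin.finite_subsets.subset (fun _ h => h.1)
  -- the `4`-sets split by the rank of the complement
  have hsplit : W4.ncard + W4'.ncard = Nat.choose n 4 := by
    have hdisj : Disjoint W4 W4' := by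
      rw [Set.disjoint_left]
      rintro B ⟨-, -, h1⟩ ⟨-, -, h2⟩
      rw [h1] at h2
      have h2' : p ≤ p - 1 := by exact_mod_cast h2
      omega
    rw [← ncard_union_eq hdisj hW4fin hW4'fin, ← hn, ← ncard_setOf_subset_ncard_eq hEfin 4]
    congr 1
    ext B
    simp only [hW4def, hW4'def, mem_union, mem_setOf_eq]
    constructor
    · rintro (⟨hB, h4, -⟩ | ⟨hB, h4, -⟩) <;> exact ⟨hB, h4⟩
    · rintro ⟨hB, h4⟩
      have hle : M.eRk (M.E \ B) ≤ (p : ℕ∞) := by rw [← hM]; exact M.eRk_le_eRank _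
      have hfin : M.eRk (M.E \ B) ≠ ⊤ := ne_top_of_le_ne_top (ENat.coe_ne_top _) hle
      obtain ⟨a, ha⟩ := ENat.ne_top_iff_exists.mp hfin
      rw [← ha] at hle ⊢
      have hle' : a ≤ p := by exact_mod_cast hle
      rcases Nat.lt_or_ge a p with hlt | hge
      · right
        refine ⟨hB, h4, ?_⟩
        exact_mod_cast (show a ≤ p - 1 by omega)
      · left
        refine ⟨hB, h4, ?_⟩
        have : a = p := by omega
        rw [this]
  -- the non-spanning complements are the low-rank `(n − 4)`-sets
  have hW4' : W4'.ncard = (lowRankSets M (n - 4) (p - 1)).ncard := by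
    have h := ncard_setOf_compl_eq M.E (fun A => A.ncard = n - 4 ∧ M.eRk A ≤ ((p - 1 : ℕ) : ℕ∞))
    have h2 : {A : Set α | A ⊆ M.E ∧ A.ncard = n - 4 ∧ M.eRk A ≤ ((p - 1 : ℕ) : ℕ∞)} =
        lowRankSets M (n - 4) (p - 1) := rfl
    rw [h2] at h
    rw [← h]
    congr 1
    ext B
    simp only [hW4'def, mem_setOf_eq]
    constructor
    · rintro ⟨hB, h4, hr⟩
      refine ⟨hB, ?_, hr⟩
      rw [ncard_sdiff' hB hEfin, hn, h4]
    · rintro ⟨hB, h4, hr⟩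
      refine ⟨hB, ?_, hr⟩
      rw [ncard_sdiff' hB hEfin, hn] at h4
      have := ncard_le_ncard hB hEfin
      rw [hn] at this
      omega
  -- `W` lies in the `4`-sets with spanning complement and the rank-`4` `k`-sets, `5 ≤ k ≤ d`
  have hcover : W ⊆ W4 ∪ ⋃ k ∈ Finset.Icc 5 d, rkSets M k 4 := by
    rintro B ⟨hB, hcomp, hB4⟩
    have hBfin : B.Finite := hEfin.subset hB
    have hlo : 4 ≤ B.ncard := by
      have := M.eRk_le_encard B
      rw [hB4, ← hBfin.cast_ncard_eq] at this
      exact_mod_cast this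
    have hhi : B.ncard ≤ d := by
      have := M.eRk_le_encard (M.E \ B)
      rw [hcomp, ← (hEfin.subset sdiff_subset).cast_ncard_eq, ncard_sdiff' hB hEfin, hn] at this
      have h' : p ≤ n - B.ncard := by exact_mod_cast this
      have := ncard_le_ncard hB hEfin
      omega
    rcases Nat.lt_or_ge 4 B.ncard with hgt | hle
    · right
      rw [mem_iUnion₂]
      exact ⟨B.ncard, Finset.mem_Icc.mpr ⟨by omega, hhi⟩, hB, rfl, hB4⟩
    · left
      exact ⟨hB, le_antisymm hle hlo, hcomp⟩
  have hWfin : (W4 ∪ ⋃ k ∈ Finset.Icc 5 d, rkSets M k 4).Finite :=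
    hW4fin.union ((Finset.Icc 5 d).finite_toSet.biUnion (fun k _ => rkSets_finite k 4))
  calc {A : Set α | A ⊆ M.E ∧ M.eRk A = (p : ℕ∞) ∧ M.eRk (M.E \ A) = ((4 : ℕ) : ℕ∞)}.ncard +
        (lowRankSets M (n - 4) (p - 1)).ncard = W.ncard + W4'.ncard := by rw [hU, hW4']
    _ ≤ (W4 ∪ ⋃ k ∈ Finset.Icc 5 d, rkSets M k 4).ncard + W4'.ncard :=
        Nat.add_le_add_right (ncard_le_ncard hcover hWfin) _
    _ ≤ W4.ncard + (⋃ k ∈ Finset.Icc 5 d, rkSets M k 4).ncard + W4'.ncard :=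
        Nat.add_le_add_right (ncard_union_le _ _) _
    _ ≤ W4.ncard + ∑ k ∈ Finset.Icc 5 d, (rkSets M k 4).ncard + W4'.ncard :=
        Nat.add_le_add_right (Nat.add_le_add_left (Finset.set_ncard_biUnion_le _ _) _) _
    _ = Nat.choose n 4 + ∑ k ∈ Finset.Icc 5 d, (rkSets M k 4).ncard := by rw [← hsplit]; ring

/-- **THE `Y`-SUM**: the `Y`-set of a cell `(p, q)` is the disjoint union of the rank levels `q + 1 … p − 1`. -/
theorem ncard_Y_eq_sum (q p : ℕ) :
    {A : Set α | A ⊆ M.E ∧ (q : ℕ∞) < M.eRk A ∧ M.eRk A < (p : ℕ∞)}.ncard =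
      ∑ r ∈ Finset.Ioo q p, (rankSet M r).ncard := by
  have heq : {A : Set α | A ⊆ M.E ∧ (q : ℕ∞) < M.eRk A ∧ M.eRk A < (p : ℕ∞)} =
      ⋃ r ∈ ((Finset.Ioo q p : Finset ℕ) : Set ℕ), rankSet M r := by
    ext A
    simp only [mem_setOf_eq, mem_iUnion, Finset.mem_coe, Finset.mem_Ioo, rankSet, exists_prop]
    constructor
    · rintro ⟨hAE, h1, h2⟩
      obtain ⟨a, ha⟩ := ENat.ne_top_iff_exists.mp (ne_top_of_lt h2)
      rw [← ha] at h1 h2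
      exact ⟨a, ⟨by exact_mod_cast h1, by exact_mod_cast h2⟩, hAE, ha.symm⟩
    · rintro ⟨a, ⟨h1, h2⟩, hAE, ha⟩
      rw [ha]
      exact ⟨hAE, by exact_mod_cast h1, by exact_mod_cast h2⟩
  have hdisj : ((Finset.Ioo q p : Finset ℕ) : Set ℕ).PairwiseDisjoint (fun r => rankSet M r) :=
    fun r _ r' _ hrr' => rankSet_disjoint M hrr'
  rw [heq, (Finset.Ioo q p).finite_toSet.ncard_biUnion (fun r _ => rankSet_finite M r) hdisj,
    finsum_mem_coe_finset]

/-- **THE RANK-CLASS COVER**: every `k`-set (`k ≥ 2`) has a rank in `2 … p`, so `C(n, k) ≤ Σ_{2 ≤ r ≤ p} m[k, r]`. -/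
theorem choose_le_sum_ncard_rkSets {p : ℕ} (hM : M.eRank = (p : ℕ∞))
    (hpairs : ∀ e ∈ M.E, ∀ f ∈ M.E, e ≠ f → M.eRk {e, f} = 2) {k : ℕ} (hk : 2 ≤ k) :
    Nat.choose M.E.ncard k ≤ ∑ r ∈ Finset.Icc 2 p, (rkSets M k r).ncard := by
  have hsub : {A : Set α | A ⊆ M.E ∧ A.ncard = k} ⊆ ⋃ r ∈ Finset.Icc 2 p, rkSets M k r := by
    rintro A ⟨hAE, hAk⟩
    have hle : M.eRk A ≤ (p : ℕ∞) := by rw [← hM]; exact M.eRk_le_eRank _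
    have hfin : M.eRk A ≠ ⊤ := ne_top_of_le_ne_top (ENat.coe_ne_top _) hle
    obtain ⟨a, ha⟩ := ENat.ne_top_iff_exists.mp hfin
    have h2 := two_le_eRk_of_two_le_ncard hpairs hAE (by omega)
    rw [← ha] at hle h2
    rw [mem_iUnion₂]
    exact ⟨a, Finset.mem_Icc.mpr ⟨by exact_mod_cast h2, by exact_mod_cast hle⟩, hAE, hAk, ha.symm⟩
  rw [← ncard_setOf_subset_ncard_eq M.ground_finite k]
  exact (ncard_le_ncard hsub ((Finset.Icc 2 p).finite_toSet.biUnion (fun r _ => rkSets_finite k r))).trans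
    (Finset.set_ncard_biUnion_le _ _)

/-- The rank classes `r ∈ R` (`r ≤ b`) of one size are disjoint subsets of the low-rank sets. -/
theorem sum_ncard_rkSets_le_ncard_lowRankSets (k b : ℕ) (R : Finset ℕ) (hR : ∀ r ∈ R, r ≤ b) :
    ∑ r ∈ R, (rkSets M k r).ncard ≤ (lowRankSets M k b).ncard := by
  have hsub : (⋃ r ∈ (R : Set ℕ), rkSets M k r) ⊆ lowRankSets M k b := by
    intro A hA
    rw [mem_iUnion₂] at hA
    obtain ⟨r, hr, hAr⟩ := hA
    refine ⟨hAr.1, hAr.2.1, ?_⟩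
    rw [hAr.2.2]
    exact_mod_cast hR r (Finset.mem_coe.mp hr)
  have hdisj : (R : Set ℕ).PairwiseDisjoint (fun r => rkSets M k r) := by
    intro r _ r' _ hrr'
    rw [Function.onFun, Set.disjoint_left]
    rintro A ⟨-, -, hAr⟩ ⟨-, -, hAr'⟩
    apply hrr'
    have h := hAr.symm.trans hAr'
    exact_mod_cast h
  have heq := R.finite_toSet.ncard_biUnion (s := fun r => rkSets M k r) (fun r _ => rkSets_finite k r) hdisj
  rw [finsum_mem_coe_finset] at heq
  rw [← heq]
  exact ncard_le_ncard hsub (lowRankSets_finite M k b)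

/-- **THE ZERO CLASSES**: in a coloop-free matroid of rank `p` on `n` points no `k`-set has rank `r < p` when
`k + (p − r + 1) > n`. -/
theorem rkSets_eq_empty_of_coloops {p n : ℕ} (hM : M.eRank = (p : ℕ∞)) (hcol : M.coloops = ∅) (hn : M.E.ncard = n)
    {k r : ℕ} (hr : r < p) (hk : n < k + (p - r + 1)) : rkSets M k r = ∅ := by
  rw [eq_empty_iff_forall_notMem]
  rintro X ⟨hXE, hXk, hXr⟩
  have hmiss := sub_add_one_le_ncard_ground_sdiff_of_coloops M hM hcol hXE hXr hr
  rw [ncard_sdiff' hXE M.ground_finite, hn, hXk] at hmiss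
  have := ncard_le_ncard hXE M.ground_finite
  rw [hn] at this
  omega

omit [M.Finite] in
/-- **THE ZERO CLASSES UNDER «LINES ≤ 3 POINTS»**: no `k`-set with `k ≥ 4` has rank `2`. -/
theorem rkSets_eq_empty_of_lines (hlines : ∀ L ⊆ M.E, M.eRk L = 2 → L.ncard ≤ 3) {k : ℕ} (hk : 3 < k) :
    rkSets M k 2 = ∅ := by
  rw [eq_empty_iff_forall_notMem]
  rintro X ⟨hXE, hXk, hX2⟩
  have := hlines X hXE hX2
  omega

section Instances

variable {M : Matroid α} [M.Finite]

/-- **THE UPWARD INSTANCE** of a simple matroid: for `b < k`,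
`(n − k)·m[k,b] ≤ (b − 1)·m[k+1,b+1] + (k+1)·m[k+1,b]` (a dependent `(k + 1)`-set of rank `b + 1` has at most
`b − 1` coloops). -/
theorem up_instance (hpairs : ∀ e ∈ M.E, ∀ f ∈ M.E, e ≠ f → M.eRk {e, f} = 2) (hE2 : 2 ≤ M.E.ncard)
    (k b : ℕ) (hkb : b < k) :
    (M.E.ncard - k) * (rkSets M k b).ncard ≤
      (b - 1) * (rkSets M (k + 1) (b + 1)).ncard + (k + 1) * (rkSets M (k + 1) b).ncard := by
  apply up_incidence k b (b - 1)
  intro S hS hSk hSb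
  rw [setOf_eRk_sdiff_eq_of_eRk_succ hSb]
  have := ncard_coloops_add_two_le_eRk hpairs hE2 hS hSb (by omega)
  omega

/-- **THE CLOSURE INSTANCE** of a simple coloop-free matroid of rank `p`: for `b ≤ k`, `b < p`,
`(k − b + 3)·m[k+1,b] ≤ (n − (p − b + 1) − k)·m[k,b]`. -/
theorem cl_instance {p : ℕ} (hM : M.eRank = (p : ℕ∞)) (hcol : M.coloops = ∅)
    (hpairs : ∀ e ∈ M.E, ∀ f ∈ M.E, e ≠ f → M.eRk {e, f} = 2) (hE2 : 2 ≤ M.E.ncard)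
    (k b : ℕ) (hbk : b ≤ k) (hbp : b < p) :
    (k - b + 3) * (rkSets M (k + 1) b).ncard ≤ (M.E.ncard - (p - b + 1) - k) * (rkSets M k b).ncard := by
  apply closure_incidence k b (k - b + 3) (M.E.ncard - (p - b + 1) - k)
  · intro S hS hSk hSb
    have h1 := ncard_le_ncard_setOf_eRk_sdiff_eq hS hSb
    have h2 := ncard_coloops_add_two_le_eRk hpairs hE2 hS hSb (by omega)
    omega
  · intro A hA hAk hAb
    have := ncard_extensions_add_le_of_coloops hM hcol hA hAb hbp
    omega

/-- **THE UPWARD INSTANCE UNDER «LINES ≤ 3 POINTS»**: for `b + 2 ≤ k`,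
`(n − k)·m[k,b] ≤ (b − 2)·m[k+1,b+1] + (k+1)·m[k+1,b]`. -/
theorem up_instance_lines (hpairs : ∀ e ∈ M.E, ∀ f ∈ M.E, e ≠ f → M.eRk {e, f} = 2)
    (hlines : ∀ L ⊆ M.E, M.eRk L = 2 → L.ncard ≤ 3) (hE2 : 2 ≤ M.E.ncard)
    (k b : ℕ) (hkb : b + 2 ≤ k) :
    (M.E.ncard - k) * (rkSets M k b).ncard ≤
      (b - 2) * (rkSets M (k + 1) (b + 1)).ncard + (k + 1) * (rkSets M (k + 1) b).ncard := by
  apply up_incidence k b (b - 2)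
  intro S hS hSk hSb
  rw [setOf_eRk_sdiff_eq_of_eRk_succ hSb]
  have := ncard_coloops_add_three_le_eRk_of_lines hpairs hlines hE2 hS hSb (by omega)
  omega

/-- **THE CLOSURE INSTANCE UNDER «LINES ≤ 3 POINTS»**: for `b + 1 ≤ k`, `b < p`,
`(k − b + 4)·m[k+1,b] ≤ (n − (p − b + 1) − k)·m[k,b]`. -/
theorem cl_instance_lines {p : ℕ} (hM : M.eRank = (p : ℕ∞)) (hcol : M.coloops = ∅)
    (hpairs : ∀ e ∈ M.E, ∀ f ∈ M.E, e ≠ f → M.eRk {e, f} = 2)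
    (hlines : ∀ L ⊆ M.E, M.eRk L = 2 → L.ncard ≤ 3) (hE2 : 2 ≤ M.E.ncard)
    (k b : ℕ) (hbk : b + 1 ≤ k) (hbp : b < p) :
    (k - b + 4) * (rkSets M (k + 1) b).ncard ≤ (M.E.ncard - (p - b + 1) - k) * (rkSets M k b).ncard := by
  apply closure_incidence k b (k - b + 4) (M.E.ncard - (p - b + 1) - k)
  · intro S hS hSk hSb
    have h1 := ncard_le_ncard_setOf_eRk_sdiff_eq hS hSb
    have h2 := ncard_coloops_add_three_le_eRk_of_lines hpairs hlines hE2 hS hSb (by omega)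
    omega
  · intro A hA hAk hAb
    have := ncard_extensions_add_le_of_coloops hM hcol hA hAb hbp
    omega

end Instances

end S1

end PercRepro
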